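import Literature.NumberTheory.EllipticCurves.IwasawaEulerCharRankZeroProofs
import Literature.NumberTheory.EllipticCurves.IwasawaAlgebraDivisibilityProofs
import HarnessLib

/-!
# The `p`-converse from the Heegner main conjecture: the `Λ`-module skeleton, proved

Sibling proof file (theorems only, no named fact, D-0014/D-0026) of
`Literature.NumberTheory.EllipticCurves.BSDSelmerPConverse`, in the story of the named fact
`burungaleSkinnerTianWan_analyticRankEK_eq_one_of_selmerCorank_eq_one` — leaf (e) of
Burungale–Skinner–Tian–Wan, *Zeta elements for elliptic curves and applications*
(arXiv:2409.01350), Thm. 1.10: the `p`-converse over the auxiliary imaginary quadratic field,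
"`corank_{ℤ_p} Sel_{p^∞}(E/K) = 1 ⟹ ord_{s=1} L(E/K, s) = 1`". Its printed proof is
Prop. 12.10 (Part II, §12.2.3, arXiv v2 PDF p. 98; "Prop. 4.10, p. 84" of the held TeX-derived text,
see the locator erratum under References): *"The `p`-converse is a consequence of the Heegner main
conjecture (cf. [26, 142] = [BuTi, W0]), and so the assertion of Proposition 12.7"*, the Heegner
main conjecture (HMC) itself being Thm. 12.9 (from Kato's main conjecture, Thm. 9.21(c), and
Howard's divisibility, Thm. 9.26). The deduction "HMC ⟹ `p`-converse" delegated to [W0] is X. Wan,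
*Heegner point Kolyvagin system and Iwasawa main conjecture*, Acta Math. Sin. (Engl. Ser.) 37
(2021) 104–120 = arXiv:1408.4043, **Theorem 3.17** (= Thm. 1.7), whose printed proof (p. 10 of the
held text) reads, with `Λ = ℤ_p⟦Γ_K^{ac}⟧ ≅ ℤ_p⟦T⟧`, `I = (T)` the augmentation ideal,
`S = H¹_𝓕(K, 𝐓)` the `Λ`-adic Selmer group containing Howard's big Heegner class `κ₁^{Hg}`, and
`X = X_{f,K}^{anti}` the dual Selmer group over the anticyclotomic tower:

> "By our discussion on Greenberg's method in subsection (control) we know that the surjection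
> `X/IX ↠ H¹_𝓕(K, E[p^∞])^*` has finite kernel. By theorem 1.1 and theorem 1.2 we have
> `M ⊗ Λ/I` [torsion] and thus `(H¹_𝓕(K, 𝐓)/Λκ₁^{Hg}) ⊗ Λ/I` is torsion. Thus
> `H¹_𝓕(K, 𝐓)/(I H¹_𝓕(K, 𝐓) + Λκ₁^{Hg})` is torsion. One can easily check that there is an
> injection `H¹_𝓕(K, 𝐓 ⊗ ℚ_p)/I ↪ H¹_𝓕(K, T ⊗ ℚ_p)`. In sum the image `κ₁` of `κ₁^{Hg}` is not
> torsion in `H¹_𝓕(K, T ⊗ ℚ_p)`. So `κ₁` is not torsion."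

Here Theorem 1.1 (Howard, *The Heegner point Kolyvagin system*, Compos. Math. 140 (2004),
Thm. B, as quoted by Wan, p. 4): *"`H¹_𝓕(K, 𝐓)` is a torsion-free rank one `Λ`-module. […] there
is a torsion `Λ`-module `M` such that `char(M) = char(M)^ι` and a pseudo-isomorphism
`X ∼ Λ ⊕ M ⊕ M`"*, and Theorem 1.2 (Wan's Heegner main conjecture, p. 4):
*"`char_Λ(M) = char_Λ(H¹_𝓕(K, 𝐓)/Λκ₁^{Hg})`"*; the non-vanishing `κ₁^{Hg} ≠ 0` is
Cornut–Vatsal, and "`κ₁` not torsion ⟹ `ord_{s=1} L(E/K, s) = 1`" is Gross–Zagier–Kolyvagin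
(tree fact `Literature.NumberTheory.EllipticCurves.analyticRankEK_eq_one_iff_heegner_nonTorsion`).

## What is proved

This file proves the **module-theoretic content of that paragraph**, unconditionally and for
abstract data over the Iwasawa algebra `Λ = IwasawaAlgebra p = ℤ_[p]⟦T⟧` (`T ↔ γ - 1`,
`I = (T)`; `Γ`-coinvariants `N_Γ = N/TN = IwasawaAlgebra.coinvariants p N`):

* `IwasawaAlgebra.pow_smul_notMem_TSubmodule_of_charIdeal_le` — **the `p`-converse lemma.**
  Let `S` be a finitely generated torsion-free `Λ`-module and `κ ∈ S`, `κ ≠ 0`, with `S/Λκ`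
  torsion ("torsion-free of rank one"); `M` a finitely generated torsion `Λ`-module; `X` a
  finitely generated `Λ`-module with a `Λ`-linear map `X → Λ ⊕ M ⊕ M` of finite cokernel
  (Howard's pseudo-isomorphism; only the finiteness of its cokernel is used); assume the
  divisibility `char_Λ(S/Λκ) ∣ char_Λ(M)`, i.e. `charIdeal M ≤ charIdeal (S/Λκ)` (the half of the
  Heegner main conjecture `char(M) = char(S/Λκ)` that is NOT Howard's, i.e. the one supplied by
  BSTW Thm. 12.9 / Wan Thm. 1.2), and `rank_{ℤ_p} X/TX ≤ 1` (`coinvariantsRank p X ≤ 1`: the control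
  theorem `X/IX ↠ Sel_{p^∞}(E/K)^∨` with finite kernel, and `corank Sel_{p^∞}(E/K) = 1`). Then
  **`p^m κ ∉ TS` for every `m`**, i.e. the image of `κ` in `S_Γ = S/IS` is not `ℤ_p`-torsion
  (`…_mkQ_ne_zero`: `p^m • (κ mod TS) ≠ 0`; `C_smul_mkQ_ne_zero_…`: `c • (κ mod TS) ≠ 0`
  for every `c ∈ ℤ_p ∖ {0}`).
* `IwasawaAlgebra.pow_smul_specialization_ne_zero` — the last sentence: if moreover
  `sp : S/IS → H` is additive with `ℤ_p`-torsion kernel ("an injection after `⊗ ℚ_p`", Wan's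
  `H¹_𝓕(K, 𝐓 ⊗ ℚ_p)/I ↪ H¹_𝓕(K, T ⊗ ℚ_p)`), then `κ₁ := sp (κ mod IS)` is not torsion:
  `p^m • κ₁ ≠ 0` for all `m`.

Proof (Wan's paragraph, run through local lengths `ℓ(N) := length_{Λ_𝔭} N_𝔭` at the height-one
prime `𝔭 = (T)` — the device of the tree's `KatoRankBoundProofs`/`IwasawaEulerCharProofs` — instead
of a chosen structure-theorem decomposition):
1. `ℓ((A ⊕ B)_Γ) = ℓ(A_Γ) + ℓ(B_Γ)` (`lengthAt_coinvariants_prod`: `Γ`-coinvariants are right exact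
   and `A_Γ → (A ⊕ B)_Γ` is split injective), and `ℓ(L_Γ) ≤ ℓ(X_Γ)` for `X → L` with finite
   cokernel (`lengthAt_coinvariants_le_of_finite_coker`: a finite `Λ`-module is killed by its
   order `n`, and `n ∉ (T)`); hence `2 ℓ(M_Γ) ≤ ℓ((Λ ⊕ M ⊕ M)_Γ) ≤ ℓ(X_Γ) = rank_{ℤ_p} X/TX ≤ 1`,
   so `ℓ(M_Γ) = 0`, i.e. **`M/IM` is finite** ("`M ⊗ Λ/I` is torsion").
2. `M/TM` finite ⟹ `T ∤ f_M` for `char(M) = (f_M)` (tree theorem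
   `order_charGenerator_eq_zero_of_finite_coinvariants`, Greenberg LNM 1716 Lemma 4.2), and
   `f_M ∈ char(S/Λκ)` by (HMC), so `ℓ(S/Λκ) ≤ ord_T f_M = 0` (tree theorem
   `lengthAt_primeT_le_order`): **`(S/Λκ)_𝔭 = 0`** ("`(S/Λκ) ⊗ Λ/I` is torsion").
3. `(S/Λκ)_𝔭 = 0` says: for every `σ ∈ S` there is `r ∉ (T)` with `r σ ∈ Λκ`. If `p^m κ = T σ`,
   write `r σ = a κ`; then `(r p^m - T a) κ = T(r σ) - T(a κ) = 0`, so `r p^m = T a ∈ (T)` as `S`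
   is torsion-free and `κ ≠ 0`, whence `r ∈ (T)` or `p ∈ (T)` — both absurd. (This replaces Wan's
   "`S/(IS + Λκ)` is torsion, and `S/IS` has `ℤ_p`-rank one" by the same computation done before
   passing to the quotient.)

## How this serves leaf (e) (and hence bsd.S25 / Thm. 1.10)

With the arithmetic inputs — (i) Howard's Thm. B for `(E, K, p)` (objects `S ∋ κ_∞`, `X`, `M`,
the pseudo-isomorphism, `κ_∞ ≠ 0` by Cornut–Vatsal), (ii) the Heegner main conjecture
(BSTW Thm. 12.9 = Prop. 12.7 + Thm. 9.21(c) + Howard's divisibility Thm. 9.26), (iii) the anticyclotomic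
control theorem `rank_{ℤ_p} X_Γ = corank_{ℤ_p} Sel_{p^∞}(E/K)` and (iv) the specialisation
`S_Γ ↪ H¹_f(K, T_pE) ⊗ ℚ` carrying `κ_∞` to the Kummer image of the Heegner point `y_K` — none of
which exists in the tree as an object yet — the theorem below yields "`y_K` is non-torsion", and
the tree fact `analyticRankEK_eq_one_iff_heegner_nonTorsion` (Gross–Zagier–Kolyvagin) turns this
into `analyticRankEK W K = 1`, the conclusion of leaf (e). Nothing here is asserted: the file adds
no `def … : Prop`.

## References

* [BurungaleSkinnerTianWan2024] A. Burungale, C. Skinner, Y. Tian, X. Wan, arXiv:2409.01350v2,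
  PRINTED numbering and arXiv v2 PDF pages: Thm. 9.21(c) (p. 84), Thm. 9.26 (p. 86), Prop. 12.7
  (p. 97), Thm. 12.9, Prop. 12.10 and its proof, Thm. 12.11 (p. 98). LOCATOR ERRATUM (2026-08-25,
  checked against the arXiv v2 PDF): earlier revisions of this file gave these as "Part II,
  Prop. 4.10, Thm. 4.9, Thm. 4.11 (pp. 83–84), Prop. 4.7, Thm. (KaMC_r)(c)" — the numbering of the
  held TeX-derived text (`lit read arxiv:2409.01350`), whose "p. N" are chunk indices, whose
  extraction restarts the section counter inside Part II (held §s = printed §(s+8)) and leaves the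
  macro (KaMC_r) = Thm. 9.21 unresolved; the quoted words are unchanged.
* [Wan2021HeegnerPointKolyvaginSystem] X. Wan, *Heegner point Kolyvagin system and Iwasawa main conjecture*,
  Acta Math. Sin. (Engl. Ser.) 37 (2021), no. 1, 104–120 = arXiv:1408.4043: Thm. 1.1, Thm. 1.2
  (p. 4), Thm. 1.7 (p. 5), Thm. 3.17 and its proof (p. 10 of the held text).
* B. Howard, *The Heegner point Kolyvagin system*, Compos. Math. 140 (2004), 1439–1472, Thm. B.
* R. Greenberg, *Iwasawa theory for elliptic curves*, LNM 1716 (1999), §4 Lemma 4.2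
  (`X/TX` finite `⟺ f(0) ≠ 0`).
-/

noncomputable section

universe u v w

namespace Literature.NumberTheory.EllipticCurves.IwasawaAlgebra

variable {p : ℕ} [Fact p.Prime]

/-! ### Local lengths of `Γ`-coinvariants at `𝔭 = (T)` -/

section Coinvariants

variable (p)

/-- **`Γ`-coinvariants of a direct sum: `ℓ_𝔭((A ⊕ B)_Γ) = ℓ_𝔭(A_Γ) + ℓ_𝔭(B_Γ)`** at `𝔭 = (T)`.
The functor `N ↦ N/TN` is right exact (`exact_coinvariantsMap`, `coinvariantsMap_surjective`), and
on the split sequence `0 → A → A ⊕ B → B → 0` the map `A/TA → (A ⊕ B)/T(A ⊕ B)` is injective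
(`(a, 0) = T (y, z)` forces `a = T y`); local lengths are additive
(`Module.lengthAt_eq_add_of_exact`). [folklore] -/
theorem lengthAt_coinvariants_prod (A : Type v) (B : Type w) [AddCommGroup A]
    [Module (IwasawaAlgebra p) A] [AddCommGroup B] [Module (IwasawaAlgebra p) B] :
    Module.lengthAt (IwasawaAlgebra p) (coinvariants p (A × B)) (primeT p) =
      Module.lengthAt (IwasawaAlgebra p) (coinvariants p A) (primeT p) +
        Module.lengthAt (IwasawaAlgebra p) (coinvariants p B) (primeT p) := by
  have hinj : Function.Injective
      (coinvariantsMap (LinearMap.inl (IwasawaAlgebra p) A B)) := by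
    rw [injective_iff_map_eq_zero]
    intro q hq
    induction q using Submodule.Quotient.induction_on with
    | H a =>
      rw [coinvariantsMap_mk, Submodule.Quotient.mk_eq_zero, mem_TSubmodule_iff] at hq
      obtain ⟨y, hy⟩ := hq
      rw [Submodule.Quotient.mk_eq_zero, mem_TSubmodule_iff]
      refine ⟨y.1, ?_⟩
      have h := congrArg Prod.fst hy
      simpa using h
  exact Module.lengthAt_eq_add_of_exact _ _ hinj
    (coinvariantsMap_surjective (LinearMap.snd (IwasawaAlgebra p) A B) LinearMap.snd_surjective)
    (exact_coinvariantsMap (LinearMap.inl (IwasawaAlgebra p) A B)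
      (LinearMap.snd (IwasawaAlgebra p) A B) LinearMap.snd_surjective .inl_snd) _

/-- A finite `Λ`-module has local length `0` at `𝔭 = (T)`: it is killed by its order `n ≥ 1`,
and the constant `n` does not lie in `(T)`. [folklore] -/
theorem lengthAt_primeT_eq_zero_of_finite (C : Type v) [AddCommGroup C]
    [Module (IwasawaAlgebra p) C] [Finite C] :
    Module.lengthAt (IwasawaAlgebra p) C (primeT p) = 0 := by
  refine Module.lengthAt_eq_zero_of_isTorsionBy (s := ((Nat.card C : ℕ) : IwasawaAlgebra p))
    (fun x ↦ ?_) (primeT p) ?_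
  · rw [Nat.cast_smul_eq_nsmul, card_nsmul_eq_zero']
  · rw [primeT_asIdeal, mem_span_X_iff, map_natCast]
    exact_mod_cast (Nat.card_pos (α := C)).ne'

/-- **`ℓ_𝔭(L_Γ) ≤ ℓ_𝔭(X_Γ)` for a `Λ`-linear map `X → L` with finite cokernel** (`𝔭 = (T)`): from
the right exact sequence `X_Γ → L_Γ → (coker)_Γ → 0` and `ℓ_𝔭((coker)_Γ) = 0`. This is all that is
used of Howard's pseudo-isomorphism `X ∼ Λ ⊕ M ⊕ M`. [folklore] -/
theorem lengthAt_coinvariants_le_of_finite_coker {X : Type v} {L : Type w} [AddCommGroup X]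
    [Module (IwasawaAlgebra p) X] [AddCommGroup L] [Module (IwasawaAlgebra p) L]
    (φ : X →ₗ[IwasawaAlgebra p] L) (hφ : Finite (L ⧸ LinearMap.range φ)) :
    Module.lengthAt (IwasawaAlgebra p) (coinvariants p L) (primeT p) ≤
      Module.lengthAt (IwasawaAlgebra p) (coinvariants p X) (primeT p) := by
  haveI := hφ
  haveI : Finite (coinvariants p (L ⧸ LinearMap.range φ)) :=
    Finite.of_surjective _ (Submodule.mkQ_surjective _)
  have hex := exact_coinvariantsMap φ (LinearMap.range φ).mkQ (Submodule.mkQ_surjective _)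
    (LinearMap.exact_map_mkQ_range φ)
  have h := Module.lengthAt_le_add_of_exact _ _ hex (primeT p)
  rwa [lengthAt_primeT_eq_zero_of_finite p (coinvariants p (L ⧸ LinearMap.range φ)),
    add_zero] at h

/-- `ℓ_𝔭(N_Γ) = rank_{ℤ_p} N/TN` in `ℕ∞` for a finitely generated `Λ`-module `N` (`𝔭 = (T)`; the
length is finite because `N_Γ` is finitely generated and killed by `T`). [folklore] -/
theorem lengthAt_coinvariants_eq_coinvariantsRank (N : Type u) [AddCommGroup N]
    [Module (IwasawaAlgebra p) N] [Module.Finite (IwasawaAlgebra p) N] :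
    Module.lengthAt (IwasawaAlgebra p) (coinvariants p N) (primeT p) =
      (coinvariantsRank p N : ℕ∞) := by
  have hne : Module.lengthAt (IwasawaAlgebra p) (coinvariants p N) (primeT p) ≠ ⊤ :=
    Module.lengthAt_ne_top_of_isTorsionBy (s := (PowerSeries.X : IwasawaAlgebra p))
      PowerSeries.X_ne_zero (fun q ↦ X_smul_coinvariants p N q) (primeT p) (height_primeT p).le
  rw [← toNat_lengthAt_coinvariants_eq_coinvariantsRank p N, ENat.coe_toNat hne]

end Coinvariants

/-! ### Wan's Theorem 3.17, module-theoretic skeleton -/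

section PConverse

variable (p)

/-- **Step 1 (Wan, proof of Thm. 3.17: "By theorem 1.1 […] we have `M ⊗ Λ/I` [torsion]").** If
`X → Λ ⊕ M ⊕ M` has finite cokernel and `rank_{ℤ_p} X/TX ≤ 1`, then `M/TM` is finite:
`2 ℓ_𝔭(M_Γ) ≤ ℓ_𝔭((Λ ⊕ M ⊕ M)_Γ) ≤ ℓ_𝔭(X_Γ) ≤ 1` forces `ℓ_𝔭(M_Γ) = 0`, and a finitely generated
`Λ`-module killed by `T` with `ℓ_𝔭 = 0` is finite.
[cite: Wan2021HeegnerPointKolyvaginSystem, Thm. 1.1 and proof of Thm. 3.17] -/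
theorem finite_coinvariants_of_coinvariantsRank_le_one {X : Type v} {M : Type u}
    [AddCommGroup X] [Module (IwasawaAlgebra p) X] [Module.Finite (IwasawaAlgebra p) X]
    [AddCommGroup M] [Module (IwasawaAlgebra p) M] [Module.Finite (IwasawaAlgebra p) M]
    (φ : X →ₗ[IwasawaAlgebra p] (IwasawaAlgebra p × M × M))
    (hφ : Finite ((IwasawaAlgebra p × M × M) ⧸ LinearMap.range φ))
    (hX : coinvariantsRank p X ≤ 1) : Finite (coinvariants p M) := by
  set l := Module.lengthAt (IwasawaAlgebra p) (coinvariants p M) (primeT p) with hl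
  have hne : l ≠ ⊤ :=
    Module.lengthAt_ne_top_of_isTorsionBy (s := (PowerSeries.X : IwasawaAlgebra p))
      PowerSeries.X_ne_zero (fun q ↦ X_smul_coinvariants p M q) (primeT p) (height_primeT p).le
  -- `2 l ≤ ℓ((Λ × M × M)_Γ) ≤ ℓ(X_Γ) ≤ 1`
  have h2 : l + l ≤ 1 := by
    have hL := lengthAt_coinvariants_le_of_finite_coker p φ hφ
    rw [lengthAt_coinvariants_prod p (IwasawaAlgebra p) (M × M), lengthAt_coinvariants_prod p M M,
      lengthAt_coinvariants_eq_coinvariantsRank p X] at hL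
    calc l + l ≤ Module.lengthAt (IwasawaAlgebra p) (coinvariants p (IwasawaAlgebra p)) (primeT p)
          + (l + l) := le_add_self
      _ ≤ (coinvariantsRank p X : ℕ∞) := hL
      _ ≤ 1 := by exact_mod_cast hX
  have h0 : l = 0 := by
    lift l to ℕ using hne with n hn
    have h2' : n + n ≤ 1 := by exact_mod_cast h2
    have : n = 0 := by omega
    simp [this]
  exact (finite_iff_lengthAt_eq_zero_of_X_smul_eq_zero p (coinvariants p M)
    (fun q ↦ X_smul_coinvariants p M q)).mpr h0

/-- **Step 2 (Wan: "and thus `(H¹_𝓕(K,𝐓)/Λκ₁^{Hg}) ⊗ Λ/I` is torsion", via Theorem 1.2).** If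
`M` is finitely generated torsion with `M/TM` finite and `char(M) ⊆ char(N)` for a finitely
generated torsion `N` (i.e. `char(N) ∣ char(M)`), then `N_𝔭 = 0` at `𝔭 = (T)`: a generator `f_M`
of `char(M)` has `T ∤ f_M` (Greenberg's Lemma 4.2, tree theorem
`order_charGenerator_eq_zero_of_finite_coinvariants`), it lies in `char(N)`, and
`ℓ_𝔭(N) ≤ ord_T f_M = 0` (`lengthAt_primeT_le_order`).
[cite: Wan2021HeegnerPointKolyvaginSystem, Thm. 1.2 and proof of Thm. 3.17] -/
theorem lengthAt_primeT_eq_zero_of_charIdeal_le {M : Type u} {N : Type v}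
    [AddCommGroup M] [Module (IwasawaAlgebra p) M] [Module.Finite (IwasawaAlgebra p) M]
    [AddCommGroup N] [Module (IwasawaAlgebra p) N] [Module.Finite (IwasawaAlgebra p) N]
    (hM : Module.IsTorsion (IwasawaAlgebra p) M) (hN : Module.IsTorsion (IwasawaAlgebra p) N)
    (hfin : Finite (coinvariants p M))
    (hle : Module.charIdeal (IwasawaAlgebra p) M ≤ Module.charIdeal (IwasawaAlgebra p) N) :
    Module.lengthAt (IwasawaAlgebra p) N (primeT p) = 0 := by
  obtain ⟨f, hf⟩ := (charIdeal_isPrincipal_holds p M).principal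
  have hf' : Module.charIdeal (IwasawaAlgebra p) M = Ideal.span {f} := hf
  have hord := order_charGenerator_eq_zero_of_finite_coinvariants p M hM f hf' hfin
  have hmem : f ∈ Module.charIdeal (IwasawaAlgebra p) N :=
    hle (hf' ▸ Ideal.mem_span_singleton_self f)
  have h := lengthAt_primeT_le_order N hN f hmem
  rw [hord] at h
  exact nonpos_iff_eq_zero.mp h

/-- **Step 3 (Wan: "Thus `H/(IH + Λκ₁^{Hg})` is torsion […] So `κ₁` is not torsion").** Let `S` be a
torsion-free `Λ`-module, `κ ∈ S` nonzero with `(S/Λκ)_𝔭 = 0` at `𝔭 = (T)`. Then `p^m κ ∉ TS` for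
every `m`: if `p^m κ = T σ`, pick `r ∉ (T)` and `a` with `r σ = a κ`; then
`(r p^m - T a) κ = 0`, so `r p^m = T a ∈ (T)`, contradicting the primality of `(T)`
(`r ∉ (T)`, `p ∉ (T)`). [cite: Wan2021HeegnerPointKolyvaginSystem, proof of Thm. 3.17] -/
theorem pow_smul_notMem_TSubmodule_of_lengthAt_eq_zero {S : Type u} [AddCommGroup S]
    [Module (IwasawaAlgebra p) S] [NoZeroSMulDivisors (IwasawaAlgebra p) S]
    {κ : S} (hκ : κ ≠ 0)
    (hS : Module.lengthAt (IwasawaAlgebra p) (S ⧸ Submodule.span (IwasawaAlgebra p) {κ})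
      (primeT p) = 0) (m : ℕ) :
    ((p : IwasawaAlgebra p) ^ m) • κ ∉ TSubmodule p S := by
  intro hmem
  obtain ⟨σ, hσ⟩ := (mem_TSubmodule_iff p S _).mp hmem
  -- `(S/Λκ)_𝔭 = 0`: some `r ∉ (T)` pushes `σ` into `Λκ`
  have hsub := (Module.lengthAt_eq_zero_iff (primeT p)).mp hS
  obtain ⟨r, hr, hrσ⟩ := LocalizedModule.subsingleton_iff.mp hsub
    (Submodule.Quotient.mk σ : S ⧸ Submodule.span (IwasawaAlgebra p) {κ})
  rw [← Submodule.Quotient.mk_smul, Submodule.Quotient.mk_eq_zero,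
    Submodule.mem_span_singleton] at hrσ
  obtain ⟨a, ha⟩ := hrσ
  -- `(r p^m - T a) κ = 0`
  have hzero : (r * (p : IwasawaAlgebra p) ^ m - PowerSeries.X * a) • κ = 0 := by
    rw [sub_smul, mul_smul, ← hσ, smul_comm r (PowerSeries.X : IwasawaAlgebra p) σ, ← ha, mul_smul,
      sub_self]
  have hzero' : r * (p : IwasawaAlgebra p) ^ m - PowerSeries.X * a = 0 :=
    (smul_eq_zero.mp hzero).resolve_right hκ
  have hmemT : r * (p : IwasawaAlgebra p) ^ m ∈ (primeT p).asIdeal := by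
    rw [sub_eq_zero] at hzero'
    rw [hzero', primeT_asIdeal]
    exact Ideal.mul_mem_right a _ (Ideal.mem_span_singleton_self _)
  rcases (primeT p).isPrime.mem_or_mem hmemT with h | h
  · exact hr h
  · have hpT : (p : IwasawaAlgebra p) ∈ (primeT p).asIdeal := (primeT p).isPrime.mem_of_pow_mem m h
    rw [primeT_asIdeal, mem_span_X_iff, map_natCast] at hpT
    exact (NeZero.ne (p : ℤ_[p])) hpT

/-- **The `p`-converse lemma (Wan 2021, Thm. 3.17 = Thm. 1.7, module-theoretic skeleton; the
deduction "Heegner main conjecture ⟹ `p`-converse" cited as [W0] = [142] in Burungale–Skinner–Tian–Wan,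
proof of Prop. 12.10).** Over `Λ = ℤ_[p]⟦T⟧` let
* `S` be finitely generated and torsion-free, `κ ∈ S` nonzero with `S/Λκ` torsion — "`H¹_𝓕(K, 𝐓)`
  is a torsion-free rank one `Λ`-module" containing Howard's class `κ₁^{Hg} ≠ 0` (Wan Thm. 1.1;
  Cornut–Vatsal);
* `M` be finitely generated torsion and `φ : X → Λ ⊕ M ⊕ M` a `Λ`-linear map with finite cokernel
  from a finitely generated `X` — Howard's pseudo-isomorphism `X ∼ Λ ⊕ M ⊕ M` for the dual Selmer
  group `X` (Wan Thm. 1.1);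
* `char_Λ(M) ⊆ char_Λ(S/Λκ)`, i.e. `char(S/Λκ) ∣ char(M)` — the Heegner main conjecture
  `char_Λ(M) = char_Λ(H¹_𝓕(K, 𝐓)/Λκ₁^{Hg})` (Wan Thm. 1.2; BSTW Thm. 12.9), of which only this
  divisibility (the one opposite to Howard's) is used;
* `rank_{ℤ_p} X/TX ≤ 1` — the control theorem "`X/IX ↠ H¹_𝓕(K, E[p^∞])^*` has finite kernel"
  together with `corank Sel_{p^∞}(E/K) = 1`.
Then `p^m κ ∉ TS` for every `m`: the image of `κ` in `S/IS` is not `ℤ_p`-torsion ("the image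
`κ₁` of `κ₁^{Hg}` is not torsion"). [cite: Wan2021HeegnerPointKolyvaginSystem, Thm. 3.17 (proof, p. 10), Thm. 1.1, Thm. 1.2]
[cite: BurungaleSkinnerTianWan2024, Prop. 12.10 (proof) and Thm. 12.9 (p. 98)] -/
theorem pow_smul_notMem_TSubmodule_of_charIdeal_le {S : Type u} {X : Type v} {M : Type w}
    [AddCommGroup S] [Module (IwasawaAlgebra p) S] [Module.Finite (IwasawaAlgebra p) S]
    [NoZeroSMulDivisors (IwasawaAlgebra p) S]
    [AddCommGroup X] [Module (IwasawaAlgebra p) X] [Module.Finite (IwasawaAlgebra p) X]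
    [AddCommGroup M] [Module (IwasawaAlgebra p) M] [Module.Finite (IwasawaAlgebra p) M]
    {κ : S} (hκ : κ ≠ 0)
    (hS : Module.IsTorsion (IwasawaAlgebra p) (S ⧸ Submodule.span (IwasawaAlgebra p) {κ}))
    (hM : Module.IsTorsion (IwasawaAlgebra p) M)
    (φ : X →ₗ[IwasawaAlgebra p] (IwasawaAlgebra p × M × M))
    (hφ : Finite ((IwasawaAlgebra p × M × M) ⧸ LinearMap.range φ))
    (hMC : Module.charIdeal (IwasawaAlgebra p) M ≤
      Module.charIdeal (IwasawaAlgebra p) (S ⧸ Submodule.span (IwasawaAlgebra p) {κ}))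
    (hX : coinvariantsRank p X ≤ 1) (m : ℕ) :
    ((p : IwasawaAlgebra p) ^ m) • κ ∉ TSubmodule p S :=
  pow_smul_notMem_TSubmodule_of_lengthAt_eq_zero p hκ
    (lengthAt_primeT_eq_zero_of_charIdeal_le p hM hS
      (finite_coinvariants_of_coinvariantsRank_le_one p φ hφ hX) hMC) m

/-- The same conclusion in `S_Γ = S/IS`: **`p^m • (κ mod TS) ≠ 0` for every `m`** — the class of
`κ` in the `Γ`-coinvariants has infinite (`p`-power) order.
[cite: Wan2021HeegnerPointKolyvaginSystem, Thm. 3.17 (proof, p. 10)] -/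
theorem pow_smul_mkQ_ne_zero_of_charIdeal_le {S : Type u} {X : Type v} {M : Type w}
    [AddCommGroup S] [Module (IwasawaAlgebra p) S] [Module.Finite (IwasawaAlgebra p) S]
    [NoZeroSMulDivisors (IwasawaAlgebra p) S]
    [AddCommGroup X] [Module (IwasawaAlgebra p) X] [Module.Finite (IwasawaAlgebra p) X]
    [AddCommGroup M] [Module (IwasawaAlgebra p) M] [Module.Finite (IwasawaAlgebra p) M]
    {κ : S} (hκ : κ ≠ 0)
    (hS : Module.IsTorsion (IwasawaAlgebra p) (S ⧸ Submodule.span (IwasawaAlgebra p) {κ}))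
    (hM : Module.IsTorsion (IwasawaAlgebra p) M)
    (φ : X →ₗ[IwasawaAlgebra p] (IwasawaAlgebra p × M × M))
    (hφ : Finite ((IwasawaAlgebra p × M × M) ⧸ LinearMap.range φ))
    (hMC : Module.charIdeal (IwasawaAlgebra p) M ≤
      Module.charIdeal (IwasawaAlgebra p) (S ⧸ Submodule.span (IwasawaAlgebra p) {κ}))
    (hX : coinvariantsRank p X ≤ 1) (m : ℕ) :
    p ^ m • (Submodule.Quotient.mk κ : coinvariants p S) ≠ 0 := by
  intro h0
  apply pow_smul_notMem_TSubmodule_of_charIdeal_le p hκ hS hM φ hφ hMC hX m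
  rw [← Nat.cast_smul_eq_nsmul (IwasawaAlgebra p), ← Submodule.Quotient.mk_smul,
    Submodule.Quotient.mk_eq_zero, Nat.cast_pow] at h0
  exact h0

/-- `ℤ_p`-form of the conclusion: **`c • (κ mod TS) ≠ 0` for every nonzero `c ∈ ℤ_p`** (acting
through `ℤ_p ⊂ Λ`, `PowerSeries.C`): write `c = u · p^v` with `u ∈ ℤ_pˣ` (`PadicInt.unitCoeff`).
So the class of `κ` in `S/IS` is not `ℤ_p`-torsion. [cite: Wan2021HeegnerPointKolyvaginSystem, Thm. 3.17 (proof, p. 10)] -/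
theorem C_smul_mkQ_ne_zero_of_charIdeal_le {S : Type u} {X : Type v} {M : Type w}
    [AddCommGroup S] [Module (IwasawaAlgebra p) S] [Module.Finite (IwasawaAlgebra p) S]
    [NoZeroSMulDivisors (IwasawaAlgebra p) S]
    [AddCommGroup X] [Module (IwasawaAlgebra p) X] [Module.Finite (IwasawaAlgebra p) X]
    [AddCommGroup M] [Module (IwasawaAlgebra p) M] [Module.Finite (IwasawaAlgebra p) M]
    {κ : S} (hκ : κ ≠ 0)
    (hS : Module.IsTorsion (IwasawaAlgebra p) (S ⧸ Submodule.span (IwasawaAlgebra p) {κ}))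
    (hM : Module.IsTorsion (IwasawaAlgebra p) M)
    (φ : X →ₗ[IwasawaAlgebra p] (IwasawaAlgebra p × M × M))
    (hφ : Finite ((IwasawaAlgebra p × M × M) ⧸ LinearMap.range φ))
    (hMC : Module.charIdeal (IwasawaAlgebra p) M ≤
      Module.charIdeal (IwasawaAlgebra p) (S ⧸ Submodule.span (IwasawaAlgebra p) {κ}))
    (hX : coinvariantsRank p X ≤ 1) {c : ℤ_[p]} (hc : c ≠ 0) :
    (PowerSeries.C c : IwasawaAlgebra p) • (Submodule.Quotient.mk κ : coinvariants p S) ≠ 0 := by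
  intro h0
  apply pow_smul_mkQ_ne_zero_of_charIdeal_le p hκ hS hM φ hφ hMC hX c.valuation
  have hu : IsUnit (PowerSeries.C ((PadicInt.unitCoeff hc : ℤ_[p])) : IwasawaAlgebra p) :=
    (Units.isUnit _).map (PowerSeries.C : ℤ_[p] →+* IwasawaAlgebra p)
  rw [PadicInt.unitCoeff_spec hc, map_mul, map_pow, map_natCast, mul_smul, hu.smul_eq_zero,
    ← Nat.cast_pow, Nat.cast_smul_eq_nsmul] at h0
  exact h0

/-- **Specialisation (Wan: "there is an injection `H¹_𝓕(K, 𝐓 ⊗ ℚ_p)/I ↪ H¹_𝓕(K, T ⊗ ℚ_p)` […]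
So `κ₁` is not torsion").** If, in the situation of
`pow_smul_mkQ_ne_zero_of_charIdeal_le`, `sp : S/IS → H` is an additive map whose kernel is
`p`-power torsion (injective after `⊗ ℚ_p`), then `κ₁ := sp (κ mod IS)` satisfies `p^m • κ₁ ≠ 0`
for every `m`. In the arithmetic application `κ₁ ∈ H¹_f(K, T_pE)` is the Kummer image of the
Heegner point `y_K`, which is therefore non-torsion, and Gross–Zagier–Kolyvagin (tree fact
`analyticRankEK_eq_one_iff_heegner_nonTorsion`) gives `ord_{s=1} L(E/K, s) = 1`.
[cite: Wan2021HeegnerPointKolyvaginSystem, Thm. 3.17 (proof, p. 10)] -/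
theorem pow_smul_specialization_ne_zero {S : Type u} {X : Type v} {M : Type w} {H : Type*}
    [AddCommGroup S] [Module (IwasawaAlgebra p) S] [Module.Finite (IwasawaAlgebra p) S]
    [NoZeroSMulDivisors (IwasawaAlgebra p) S]
    [AddCommGroup X] [Module (IwasawaAlgebra p) X] [Module.Finite (IwasawaAlgebra p) X]
    [AddCommGroup M] [Module (IwasawaAlgebra p) M] [Module.Finite (IwasawaAlgebra p) M]
    [AddCommGroup H]
    {κ : S} (hκ : κ ≠ 0)
    (hS : Module.IsTorsion (IwasawaAlgebra p) (S ⧸ Submodule.span (IwasawaAlgebra p) {κ}))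
    (hM : Module.IsTorsion (IwasawaAlgebra p) M)
    (φ : X →ₗ[IwasawaAlgebra p] (IwasawaAlgebra p × M × M))
    (hφ : Finite ((IwasawaAlgebra p × M × M) ⧸ LinearMap.range φ))
    (hMC : Module.charIdeal (IwasawaAlgebra p) M ≤
      Module.charIdeal (IwasawaAlgebra p) (S ⧸ Submodule.span (IwasawaAlgebra p) {κ}))
    (hX : coinvariantsRank p X ≤ 1)
    (sp : coinvariants p S →+ H) (hsp : ∀ x, sp x = 0 → ∃ n : ℕ, p ^ n • x = 0) (m : ℕ) :
    p ^ m • sp (Submodule.Quotient.mk κ) ≠ 0 := by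
  intro h0
  rw [← map_nsmul] at h0
  obtain ⟨n, hn⟩ := hsp _ h0
  rw [← mul_nsmul', ← pow_add] at hn
  exact pow_smul_mkQ_ne_zero_of_charIdeal_le p hκ hS hM φ hφ hMC hX (n + m) hn

end PConverse

/-! ### Appendix: `rank_{ℤ_p} X_Γ` is a pseudo-isomorphism invariant; Wan's rank count

Wan's sentence "By theorem 1.1 […] we have `M ⊗ Λ/I` [torsion]" is, in full, the count
`rank_{ℤ_p} X/IX = rank_{ℤ_p} Λ/I + 2 rank_{ℤ_p} M/IM = 1 + 2 rank_{ℤ_p} M/IM` along Howard's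
pseudo-isomorphism `X ∼ Λ ⊕ M ⊕ M` (finite kernel and cokernel). The main theorem above only needs
the inequality coming from the finite cokernel; for the record we prove the invariance of
`ℓ_𝔭(N_Γ) = rank_{ℤ_p} N_Γ` under maps with finite kernel and cokernel (snake lemma for
multiplication by `T`, tree `exact_snakeDelta_coinvariantsMap`) and the exact count. -/

section PseudoIsomorphism

variable (p)

/-- `ℓ_𝔭(X_Γ) = ℓ_𝔭(Y_Γ)` for a surjection `X ↠ Y` with finite kernel (`𝔭 = (T)`): right
exactness `K_Γ → X_Γ → Y_Γ → 0` and `ℓ_𝔭(K_Γ) = 0`. [folklore] -/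
theorem lengthAt_coinvariants_eq_of_surjective_of_finite_ker {X : Type v} {Y : Type w}
    [AddCommGroup X] [Module (IwasawaAlgebra p) X] [AddCommGroup Y] [Module (IwasawaAlgebra p) Y]
    (ψ : X →ₗ[IwasawaAlgebra p] Y) (hψ : Function.Surjective ψ)
    (hker : Finite (LinearMap.ker ψ)) :
    Module.lengthAt (IwasawaAlgebra p) (coinvariants p X) (primeT p) =
      Module.lengthAt (IwasawaAlgebra p) (coinvariants p Y) (primeT p) := by
  haveI := hker
  haveI : Finite (coinvariants p (LinearMap.ker ψ)) :=
    Finite.of_surjective _ (Submodule.mkQ_surjective _)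
  refine le_antisymm ?_ ?_
  · have hex := exact_coinvariantsMap (LinearMap.ker ψ).subtype ψ hψ (LinearMap.exact_subtype_ker_map ψ)
    have h := Module.lengthAt_le_add_of_exact _ _ hex (primeT p)
    rwa [lengthAt_primeT_eq_zero_of_finite p (coinvariants p (LinearMap.ker ψ)), zero_add] at h
  · exact length_localizedModule_primeT_le_of_surjective p _ (coinvariantsMap_surjective ψ hψ)

/-- `ℓ_𝔭(X_Γ) = ℓ_𝔭(L_Γ)` for an injection `X ↪ L` with finite cokernel `C` (`𝔭 = (T)`): the
snake lemma for multiplication by `T` gives `C[T] → X_Γ → L_Γ → C_Γ → 0`, and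
`ℓ_𝔭(C[T]) = ℓ_𝔭(C_Γ) = 0`. [folklore] -/
theorem lengthAt_coinvariants_eq_of_injective_of_finite_coker {X : Type v} {L : Type w}
    [AddCommGroup X] [Module (IwasawaAlgebra p) X] [AddCommGroup L] [Module (IwasawaAlgebra p) L]
    (ι : X →ₗ[IwasawaAlgebra p] L) (hι : Function.Injective ι)
    (hcoker : Finite (L ⧸ LinearMap.range ι)) :
    Module.lengthAt (IwasawaAlgebra p) (coinvariants p X) (primeT p) =
      Module.lengthAt (IwasawaAlgebra p) (coinvariants p L) (primeT p) := by
  haveI := hcoker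
  refine le_antisymm ?_ (lengthAt_coinvariants_le_of_finite_coker p ι hcoker)
  haveI : Finite (invariants p (L ⧸ LinearMap.range ι)) :=
    Finite.of_injective _ (Submodule.subtype_injective _)
  have hex := exact_snakeDelta_coinvariantsMap ι (LinearMap.range ι).mkQ hι
    (Submodule.mkQ_surjective _) (LinearMap.exact_map_mkQ_range ι)
  have h := Module.lengthAt_le_add_of_exact _ _ hex (primeT p)
  rwa [lengthAt_primeT_eq_zero_of_finite p (invariants p (L ⧸ LinearMap.range ι)), zero_add] at h

/-- **`ℓ_𝔭(X_Γ) = ℓ_𝔭(L_Γ)` along a `Λ`-linear map with finite kernel and cokernel**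
(a pseudo-isomorphism of finitely generated `Λ`-modules; `𝔭 = (T)`), through
`X ↠ range ↪ L`. Hence `rank_{ℤ_p} X/TX = rank_{ℤ_p} L/TL` (`coinvariantsRank_eq_of_finite_ker_coker`).
[folklore] -/
theorem lengthAt_coinvariants_eq_of_finite_ker_coker {X : Type v} {L : Type w}
    [AddCommGroup X] [Module (IwasawaAlgebra p) X] [AddCommGroup L] [Module (IwasawaAlgebra p) L]
    (φ : X →ₗ[IwasawaAlgebra p] L) (hker : Finite (LinearMap.ker φ))
    (hcoker : Finite (L ⧸ LinearMap.range φ)) :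
    Module.lengthAt (IwasawaAlgebra p) (coinvariants p X) (primeT p) =
      Module.lengthAt (IwasawaAlgebra p) (coinvariants p L) (primeT p) := by
  have h1 := lengthAt_coinvariants_eq_of_surjective_of_finite_ker p φ.rangeRestrict
    φ.surjective_rangeRestrict (by rwa [LinearMap.ker_rangeRestrict])
  have h2 := lengthAt_coinvariants_eq_of_injective_of_finite_coker p (LinearMap.range φ).subtype
    (Submodule.subtype_injective _) (by rwa [Submodule.range_subtype])
  exact h1.trans h2

/-- `rank_{ℤ_p} X/TX = rank_{ℤ_p} L/TL` for finitely generated `X`, `L` and a `Λ`-linear `X → L`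
with finite kernel and cokernel. [folklore] -/
theorem coinvariantsRank_eq_of_finite_ker_coker {X : Type u} {L : Type u}
    [AddCommGroup X] [Module (IwasawaAlgebra p) X] [Module.Finite (IwasawaAlgebra p) X]
    [AddCommGroup L] [Module (IwasawaAlgebra p) L] [Module.Finite (IwasawaAlgebra p) L]
    (φ : X →ₗ[IwasawaAlgebra p] L) (hker : Finite (LinearMap.ker φ))
    (hcoker : Finite (L ⧸ LinearMap.range φ)) :
    coinvariantsRank p X = coinvariantsRank p L := by
  have h := lengthAt_coinvariants_eq_of_finite_ker_coker p φ hker hcoker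
  rw [lengthAt_coinvariants_eq_coinvariantsRank p X, lengthAt_coinvariants_eq_coinvariantsRank p L]
    at h
  exact_mod_cast h

/-- `ℓ_𝔭(Λ_Γ) = 1`: `Λ/TΛ = Λ/𝔭` is the residue ring of the height-one prime `𝔭 = (T)`
(`rank_{ℤ_p} Λ/TΛ = rank_{ℤ_p} ℤ_p = 1`). [folklore] -/
theorem lengthAt_coinvariants_self :
    Module.lengthAt (IwasawaAlgebra p) (coinvariants p (IwasawaAlgebra p)) (primeT p) = 1 := by
  have hI : (Ideal.span {(PowerSeries.X : IwasawaAlgebra p)} •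
      (⊤ : Submodule (IwasawaAlgebra p) (IwasawaAlgebra p))) =
        (Ideal.span {(PowerSeries.X : IwasawaAlgebra p)} : Ideal (IwasawaAlgebra p)) := by
    rw [Ideal.smul_eq_mul, Ideal.mul_top]
  rw [Module.lengthAt_eq_of_linearEquiv (Submodule.quotEquivOfEq _ _ hI) (primeT p)]
  exact Module.lengthAt_quotient_self (primeT p)

/-- `rank_{ℤ_p} Λ/TΛ = 1`. [folklore] -/
theorem coinvariantsRank_self : coinvariantsRank p (IwasawaAlgebra p) = 1 := by
  have h := lengthAt_coinvariants_self p
  rw [lengthAt_coinvariants_eq_coinvariantsRank p (IwasawaAlgebra p)] at h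
  exact_mod_cast h

/-- **Wan's count along Howard's pseudo-isomorphism:
`rank_{ℤ_p} X/IX = 1 + 2 · rank_{ℤ_p} M/IM`** for a `Λ`-linear `X → Λ ⊕ M ⊕ M` with finite kernel
and cokernel (`X`, `M` finitely generated). In particular `rank_{ℤ_p} X/IX = 1` iff `M/IM` is
finite. [cite: Wan2021HeegnerPointKolyvaginSystem, Thm. 1.1 and proof of Thm. 3.17] -/
theorem coinvariantsRank_eq_one_add_two_mul {X : Type u} {M : Type u}
    [AddCommGroup X] [Module (IwasawaAlgebra p) X] [Module.Finite (IwasawaAlgebra p) X]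
    [AddCommGroup M] [Module (IwasawaAlgebra p) M] [Module.Finite (IwasawaAlgebra p) M]
    (φ : X →ₗ[IwasawaAlgebra p] (IwasawaAlgebra p × M × M)) (hker : Finite (LinearMap.ker φ))
    (hcoker : Finite ((IwasawaAlgebra p × M × M) ⧸ LinearMap.range φ)) :
    coinvariantsRank p X = 1 + 2 * coinvariantsRank p M := by
  have h := lengthAt_coinvariants_eq_of_finite_ker_coker p φ hker hcoker
  rw [lengthAt_coinvariants_prod p (IwasawaAlgebra p) (M × M), lengthAt_coinvariants_prod p M M,
    lengthAt_coinvariants_self p, lengthAt_coinvariants_eq_coinvariantsRank p X,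
    lengthAt_coinvariants_eq_coinvariantsRank p M] at h
  have h' : coinvariantsRank p X = 1 + (coinvariantsRank p M + coinvariantsRank p M) := by
    exact_mod_cast h
  omega

end PseudoIsomorphism

end Literature.NumberTheory.EllipticCurves.IwasawaAlgebra

end
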